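/-
Copyright (c) 2026 the pub-hodgecm-mathlib formalisation cell (harness21).  Prover seats hodgecm-mathlib-K2Liu-p09 (g5, g6): Track B «K2-LIT»,
hLiu418 = stmt-HodgeConjecture-24832; LEAD F0P6-plan RULINGS M-156m∕o, M-157a (4)∕c∕m «A7 = GK COCYCLE ROAD», file B7 (every place).
-/
import Summits.HodgeConjecture.HodgeConjecture.Theorems.K2LiuA7NormalisedRegularityNonsplit   -- ★ B7 (one place above `v`)
import Summits.HodgeConjecture.HodgeConjecture.Theorems.K2LiuA7NormalisedRegularitySplit      -- ★ B7s (two places above `v`)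
import HarnessLib

/-!
# Crux `HLiu418`, road `K2_Liu`, organ A7-reg (GK cocycle road), file B7 (every finite place):
# BAD-PLACE REGULARITY OF THE NORMALISED SIEGEL INTERTWINING OPERATOR AT `s = ½` — the (A4′-R) face at EVERY finite place `v` of `F`

Cell `hodgecm-mathlib`, crux item hLiu418 = `stmt-HodgeConjecture-24832`; squad K2 ∕ K2Liu; provers K2Liu-p09 (g5, g6).  THEOREMS ONLY; lane
`--supports stmt-HodgeConjecture-24832` (count-neutral helper).  ONE FRAME (RULING M-156o (c)): `φ := frameConj Q ∘ toLocalFour` (★ B1b-1, K2Liu-p03 (g6)); the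
adapted-frame data `(D, Dinv, Q)` are hypotheses (the frame owner's bridge B8 supplies them for the CM datum).
THE POINT (RULING M-156m: A7 = the Gindikin–Karpelevich COCYCLE road; ⟦R-χ⟧ unitarity, ⟦R-Iw⟧ Iwasawa compact `K₀` as data, ⟦R-sm⟧ smoothness).  For `χ_v` unitary,
a compact open `K₀ ≤ H_v` with `H_v = P_Δ(F_v) K₀`, and a family `f_s` of smooth Siegel sections of `I_v(s, χ_v)` flat on `K₀`, there is an EXPLICIT `Fn : ℂ → H_v → ℂ`,
each `s ↦ Fn s h` a rational function of `q_v^{-s}` regular at `½`, with **`M_v(s) f_s (h) = aNorm 2 χ_v (νN(N_Δ ∩ K₀)) s · Fn s h` on `1 < re s`** — at EVERY finite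
place `v` (inert, ramified or split: the BAD places included).  This file only combines ★ B7 `normalisedRegularity_of_forall_eq` (one place of `E` above `v`) and ★ B7s
`normalisedRegularity_of_pair` (two places) over ★ B7-R (R1) `placesOver_cases'` (a quadratic `E/F` has one or two places above `v`).
HONEST LABEL.  `HC_CM` is proved only modulo the 7 printed citations (2 remaining named inputs: hLiu418 = `stmt-HodgeConjecture-24832`,
h413 = `stmt-HodgeConjecture-24833`) until rung 0 closes.

## References
* [KudlaSweet1997] S. Kudla, W. J. Sweet, *Degenerate principal series representations for U(n,n)*, Israel J. Math. 98 (1997), §1.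
* [HarrisKudlaSweet1996] M. Harris, S. Kudla, W. J. Sweet, J. AMS 9 (1996), §6 (6.14)–(6.16) (the normalising factor `a_v(s)`).
* [Casselman1980] W. Casselman, *The unramified principal series of p-adic groups I*, Compositio Math. 40 (1980), §3 Thm. 3.1 (rank-one operators, cocycle).
* [CasselsFrohlichANT1967] J. W. S. Cassels, A. Fröhlich (eds.), *Algebraic Number Theory* (1967), Ch. VII Prop. 1.2 (ii) (places of a quadratic extension).
-/

set_option autoImplicit false
set_option linter.dupNamespace false -- the mandated namespace repeats `HodgeConjecture.HodgeConjecture`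

noncomputable section

open scoped Classical NNReal ENNReal
open NumberField IsDedekindDomain Matrix MeasureTheory Topology
open Literature.NumberTheory.GaloisRepresentations.IsNonarchimedeanLocalField
open Literature.NumberTheory.Automorphic Literature.NumberTheory.Automorphic.UnitaryGroup
open Literature.NumberTheory.GelbartRogawski1991.AdaptedBlocks
open Literature.NumberTheory.GelbartRogawski1991.UnitaryDualPair.LocalSplitting
open Literature.NumberTheory.K2Lit.LocalSiegelDoubled
open Summit.HodgeConjecture.HodgeConjecture.Cruxes.HLiu418.K2LiuQRationalDefs
open Summit.HodgeConjecture.HodgeConjecture.Cruxes.HLiu418.K2LiuLocalLFactorDefs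
open Summit.HodgeConjecture.HodgeConjecture.Cruxes.HLiu418.K2LiuLocalSiegelIwasawaFrame
open Summit.HodgeConjecture.HodgeConjecture.Cruxes.HLiu418.K2LiuLocalSiegelIwasawa
open Summit.HodgeConjecture.HodgeConjecture.Cruxes.HLiu418.K2LiuDoubledUTwoTwoFrameTransport
open Summit.HodgeConjecture.HodgeConjecture.Cruxes.HLiu418.K2LiuDoubledUTwoTwoUnipotentHaar
open Summit.HodgeConjecture.HodgeConjecture.Cruxes.HLiu418.K2LiuLocalRingPlaceDecomposition
open Summit.HodgeConjecture.HodgeConjecture.Cruxes.HLiu418.K2LiuA7NormalisedRegularityNonsplit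
open Summit.HodgeConjecture.HodgeConjecture.Cruxes.HLiu418.K2LiuA7NormalisedRegularitySplit

namespace Summit.HodgeConjecture.HodgeConjecture.Cruxes.HLiu418.K2LiuA7NormalisedRegularity

variable (F : Type) [Field F] [NumberField F] (E : Type) [Field E] [NumberField E] [Algebra F E]
  [Algebra.IsQuadraticExtension F E] (c : E ≃ₐ[F] E)
  {δ : E} (hcδ : c δ = -δ) (hδ : δ ≠ 0) {d : F} (hd : δ * δ = algebraMap F E d) (v : HeightOneSpectrum (𝓞 F))
  {T₂ : Matrix (Fin 2) (Fin 2) F} (hT₂ : T₂.IsSymm) {J₂D : Matrix (Fin (2 + 2)) (Fin (2 + 2)) E} (hJ₂D : J₂D = (gramD F 2 T₂).map (algebraMap F E))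
  (D Dinv : Matrix (Fin 2) (Fin 2) F) (hDD : D * Dinv = 1) (hDD' : Dinv * D = 1) (Q : GL (Fin (2 + 2)) F)
  (hQm : (Q : Matrix (Fin (2 + 2)) (Fin (2 + 2)) F) = Matrix.reindex (e₂ 2) (e₂ 2) (Matrix.fromBlocks 1 D 1 (-D)))
  (hQ : (Q : Matrix (Fin (2 + 2)) (Fin (2 + 2)) F)ᵀ * gramD F 2 T₂ * (Q : Matrix (Fin (2 + 2)) (Fin (2 + 2)) F) = (StdForm.antidiagonal (2 + 2)).over F)

include hcδ hδ hd hT₂ hDD hDD' hQm hQ in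
/-- **(A4′-R) AT EVERY FINITE PLACE — BAD-PLACE REGULARITY OF THE NORMALISED SIEGEL INTERTWINING OPERATOR AT `½`.**  For `χ_v` unitary, a compact open subgroup
`K₀ ≤ H_v` with the Iwasawa property `H_v = P_Δ(F_v)·K₀`, and a family `f` of smooth Siegel sections of `I_v(s, χ_v)` whose restriction to `K₀` does not depend on `s`,
there is `Fn : ℂ → H_v → ℂ` with every `s ↦ Fn s h` rational in `q_v^{-s}` and regular at `½`, such that `M_v(s)(f s) h = aNorm 2 χ_v (νN(N_Δ ∩ K₀)) s · Fn s h` for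
`1 < re s` (one place of `E` above `v`: ★ B7; two places: ★ B7s; ★ B7-R (R1)). [cite: KudlaSweet1997, §1] [cite: HarrisKudlaSweet1996, §6 (6.14)–(6.16)]
[cite: Casselman1980, §3 Thm. 3.1] [cite: CasselsFrohlichANT1967, Ch. VII Prop. 1.2 (ii)] -/
theorem normalisedRegularity
    [MeasurableSpace (unipDeltaLocal F E c v 2 (JD := J₂D))] [BorelSpace (unipDeltaLocal F E c v 2 (JD := J₂D))]
    (νN : Measure (unipDeltaLocal F E c v 2 (JD := J₂D))) [νN.IsHaarMeasure]
    (χv : ∀ w : PlacesOver E v, (w.1.adicCompletion E)ˣ →* ℂˣ) (hχ : ∀ (w' : PlacesOver E v) (x : (w'.1.adicCompletion E)ˣ), ‖((χv w' x : ℂˣ) : ℂ)‖ = 1)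
    (K₀ : Subgroup (UnitaryGroup.localPi E c (2 + 2) J₂D v))
    (hK₀ : IsCompact (K₀ : Set (UnitaryGroup.localPi E c (2 + 2) J₂D v)) ∧ IsOpen (K₀ : Set (UnitaryGroup.localPi E c (2 + 2) J₂D v)))
    (hIw : ∀ g : UnitaryGroup.localPi E c (2 + 2) J₂D v, ∃ p, IsSiegelDelta F E c hcδ hδ hd v 2 hT₂ hJ₂D p ∧ ∃ k ∈ K₀, g = p * k)
    (f : ℂ → UnitaryGroup.localPi E c (2 + 2) J₂D v → ℂ) (hSieg : ∀ s, IsLocalSiegelSection F E c hcδ hδ hd v 2 hT₂ hJ₂D χv s (f s)) (hsm : ∀ s, IsSmooth F E c v 2 (f s))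
    (hflat : ∀ s s' : ℂ, ∀ k ∈ K₀, f s k = f s' k) :
    ∃ Fn : ℂ → UnitaryGroup.localPi E c (2 + 2) J₂D v → ℂ,
      (∀ h, IsQRationalRegularAt (residueFieldCard (v.adicCompletion F)) (1 / 2) (fun s => Fn s h)) ∧
      ∀ s : ℂ, 1 < s.re → ∀ h : UnitaryGroup.localPi E c (2 + 2) J₂D v,
        localIntertwining F E c v 2 hJ₂D νN (f s) h = aNorm F E c v 2 χv (νN.real {u | (u : UnitaryGroup.localPi E c (2 + 2) J₂D v) ∈ K₀}) s * Fn s h := by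
  rcases placesOver_cases' F E c v hcδ hδ with ⟨w, hw⟩ | ⟨w₁, w₂, hne, hw⟩
  · exact normalisedRegularity_of_forall_eq F E c hcδ hδ hd v hT₂ hJ₂D D Dinv hDD hDD' Q hQm hQ νN χv hχ K₀ hK₀ hIw f hSieg hsm hflat w hw
  · exact normalisedRegularity_of_pair F E c hcδ hδ hd v hT₂ hJ₂D D Dinv hDD hDD' Q hQm hQ νN χv hχ K₀ hK₀ hIw f hSieg hsm hflat w₁ w₂ hne hw

end Summit.HodgeConjecture.HodgeConjecture.Cruxes.HLiu418.K2LiuA7NormalisedRegularity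

end
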